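import Literature.MathematicalPhysics.QuantumManyBody.PeriodicBoseGasFracEnergy

/-!
# Route BECIroning, support item `ShellModeCounting` (stmt-AtomisticToContinuum-11430): lemmas

Helper file (`--supports stmt-AtomisticToContinuum-11430`) for
`BECIroningShellModeCounting.lean`, which closes `…Theses.BECIroning.ShellModeCounting`.
Contents (namespace `…Theorems.ShellCounting`):

* §1 lattice bookkeeping for the cubes `{-R,…,R}³ ⊂ ℤ³` written, as in the route file, as order
  intervals `Finset.Icc (-R) R` of `Fin 3 → ℤ` (`mem_cube`, `sq_le_normSq_of_not_mem_cube`, …) and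
  the Markov step `∑_B w ≤ c ∑_B |2πn/L|² w` when `c|2πn/L|² ≥ 1` on `B`;
* §2 **the dyadic summation** `dyadic_sum_le`: shell-averaged kinetic bounds
  `∑_{0<‖n‖_∞≤2^j} |2πn/L|² w_n ≤ C(2^j)³(p + (2^j)²/L²)` (`j ≤ J`) give
  `∑_{0<‖n‖_∞≤2^J} w_n ≤ (2C/π²)(pL²2^J + (2^J)³)` (mode counting in `d = 3`, the shape of
  [DysonLiebSimon1978] / [KLS1988PRL]); the dyadic cut-off `exists_pow_two_near`; and the real
  arithmetic `ir_arith` turning the dyadic bound into `≤ N/4` under the route's thresholds;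
* §3 the counting step `condensate_ge_half_of_cube` (Parseval on the torus, tree file
  `PeriodicBoseGasFracEnergy`: `N = ∑_k n_k ≤ n₀ + ∑_{IR cube} n_k + D⁻¹⟨Ψ,HΨ⟩`), adapted from
  `ModeCounting.condensate_ge_half` of `BECGroundStateSOSIRModeCounting.lean` (cube instead of an
  `1/‖k‖_∞` infrared profile).

## References

* [LSSY2005] Lieb, Seiringer, Solovej, Yngvason, *The Mathematics of the Bose Gas and its
  Condensation* (2005), §1.2 (1.17)–(1.19).
* [KLS1988PRL] Kennedy, Lieb, Shastry, Phys. Rev. Lett. 61 (1988) 2582 (IR bound ⇒ LRO).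
* [DysonLiebSimon1978] Dyson, Lieb, Simon, J. Stat. Phys. 18 (1978) 335 (mode counting in `d = 3`).
-/

noncomputable section

open MeasureTheory Filter
open scoped ENNReal NNReal BigOperators

namespace Summit.AtomisticToContinuum.BoseEinsteinCondensation.Theorems

namespace ShellCounting

open Literature.MathematicalPhysics.QuantumManyBody.BoseGas

/-! ## §1 Lattice bookkeeping: the cubes `{-R,…,R}³` as order intervals of `ℤ³` -/

-- The cube `{-R, …, R}³ ⊂ ℤ³` (closed sup-norm ball of radius `R ∈ ℕ`) is written, as in the
-- route file, as the order interval `Finset.Icc (fun _ => -(R : ℤ)) (fun _ => (R : ℤ))` of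
-- `Fin 3 → ℤ`, and `|n|² = ∑ᵢ nᵢ²` as `∑ i, ((n i : ℤ) : ℝ) ^ 2` (no notation, no new definition).

/-- Membership in the cube is `|n_j| ≤ R` for all `j`. [folklore] -/
theorem mem_cube {R : ℕ} {n : Fin 3 → ℤ} :
    n ∈ Finset.Icc (fun _ : Fin 3 => -(R : ℤ)) (fun _ : Fin 3 => (R : ℤ)) ↔
      ∀ j, |n j| ≤ (R : ℤ) := by
  simp only [Finset.mem_Icc, Pi.le_def, abs_le, forall_and]

/-- `0 ∈ {-R,…,R}³`. [folklore] -/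
theorem zero_mem_cube (R : ℕ) :
    (0 : Fin 3 → ℤ) ∈ Finset.Icc (fun _ : Fin 3 => -(R : ℤ)) (fun _ : Fin 3 => (R : ℤ)) :=
  mem_cube.2 fun j => by simp

/-- The cubes increase with the radius. [folklore] -/
theorem cube_mono {R R' : ℕ} (h : R ≤ R') :
    Finset.Icc (fun _ : Fin 3 => -(R : ℤ)) (fun _ : Fin 3 => (R : ℤ)) ⊆
      Finset.Icc (fun _ : Fin 3 => -(R' : ℤ)) (fun _ : Fin 3 => (R' : ℤ)) := fun _ hn =>
  mem_cube.2 fun j => ((mem_cube.1 hn) j).trans (by exact_mod_cast h)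

/-- Outside the cube of radius `R` the Euclidean norm is at least `R + 1` (integrality):
`(R+1)² ≤ |n|²`. [folklore] -/
theorem sq_le_normSq_of_not_mem_cube {R : ℕ} {n : Fin 3 → ℤ}
    (hn : n ∉ Finset.Icc (fun _ : Fin 3 => -(R : ℤ)) (fun _ : Fin 3 => (R : ℤ))) :
    ((R : ℝ) + 1) ^ 2 ≤ (∑ i, ((n i : ℤ) : ℝ) ^ 2) := by
  rw [mem_cube] at hn
  push Not at hn
  obtain ⟨j, hj⟩ := hn
  have h1 : (R : ℝ) + 1 ≤ |((n j : ℤ) : ℝ)| := by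
    rw [← Int.cast_abs]
    exact_mod_cast (show (R : ℤ) + 1 ≤ |n j| from hj)
  have h0 : (0 : ℝ) ≤ (R : ℝ) + 1 := by positivity
  calc ((R : ℝ) + 1) ^ 2 ≤ |((n j : ℤ) : ℝ)| ^ 2 := pow_le_pow_left₀ h0 h1 2
    _ = ((n j : ℤ) : ℝ) ^ 2 := sq_abs _
    _ ≤ (∑ i, ((n i : ℤ) : ℝ) ^ 2) :=
        Finset.single_le_sum (fun i _ => sq_nonneg (((n i : ℤ) : ℝ))) (Finset.mem_univ j)

/-- A non-zero lattice point has `|n|² ≥ 1`. [folklore] -/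
theorem one_le_normSq_of_ne_zero {n : Fin 3 → ℤ} (hn : n ≠ 0) :
    (1 : ℝ) ≤ (∑ i, ((n i : ℤ) : ℝ) ^ 2) := by
  have h : n ∉ Finset.Icc (fun _ : Fin 3 => -((0 : ℕ) : ℤ)) (fun _ : Fin 3 => ((0 : ℕ) : ℤ)) :=
      fun h => hn (by
    funext j
    have hj := (mem_cube.1 h) j
    simp only [Nat.cast_zero, abs_nonpos_iff] at hj
    exact hj)
  simpa using sq_le_normSq_of_not_mem_cube h

/-- **Markov on a set of modes**: if `c·|2πn/L|² ≥ 1` on `B`, then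
`∑_{n ∈ B} w_n ≤ c ∑_{n ∈ B} |2πn/L|² w_n`. [folklore] -/
theorem sum_le_ofReal_mul_sum_weighted {L c : ℝ} (hc : 0 ≤ c) (B : Finset (Fin 3 → ℤ))
    (w : (Fin 3 → ℤ) → ℝ≥0∞)
    (hB : ∀ n ∈ B, 1 ≤ c * (4 * Real.pi ^ 2 * (∑ i, ((n i : ℤ) : ℝ) ^ 2) / L ^ 2)) :
    ∑ n ∈ B, w n ≤
      ENNReal.ofReal c *
        ∑ n ∈ B, ENNReal.ofReal (4 * Real.pi ^ 2 * (∑ i, ((n i : ℤ) : ℝ) ^ 2) / L ^ 2) * w n := by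
  rw [Finset.mul_sum]
  refine Finset.sum_le_sum fun n hn => ?_
  calc w n = 1 * w n := (one_mul _).symm
    _ ≤ (ENNReal.ofReal c *
          ENNReal.ofReal (4 * Real.pi ^ 2 * (∑ i, ((n i : ℤ) : ℝ) ^ 2) / L ^ 2)) * w n := by
        gcongr
        rw [← ENNReal.ofReal_mul hc]
        exact ENNReal.one_le_ofReal.2 (hB n hn)
    _ = ENNReal.ofReal c *
          (ENNReal.ofReal (4 * Real.pi ^ 2 * (∑ i, ((n i : ℤ) : ℝ) ^ 2) / L ^ 2) * w n) :=
        mul_assoc _ _ _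

/-! ## §2 The dyadic summation of the shell bounds -/

/-- **Dyadic mode counting (the IR step).** Let `w_n ≥ 0` (`n ∈ ℤ³`) and suppose the shell-averaged
kinetic bounds `∑_{0 < ‖n‖_∞ ≤ 2^j} |2πn/L|² w_n ≤ C (2^j)³ (p + (2^j)²/L²)` for `j = 0, …, J`. Then
`∑_{0 < ‖n‖_∞ ≤ 2^J} w_n ≤ (2C/π²)(p L² 2^J + (2^J)³)`: on the dyadic shell `2^j < ‖n‖_∞ ≤ 2^{j+1}`
one has `|2πn/L|² ≥ 4π²4^j/L²`, so the shell carries at most `(C/π²)(pL²2^{j+1} + 8^{j+1})`, and the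
two geometric series sum to at most twice their last terms (induction on `J`).
[cite: DysonLiebSimon1978, §4 (mode counting in d = 3)] -/
theorem dyadic_sum_le {L C p : ℝ} (hL : 0 < L) (hC : 0 ≤ C) (hp : 0 ≤ p)
    (w : (Fin 3 → ℤ) → ℝ≥0∞) (J : ℕ)
    (hB : ∀ j, j ≤ J →
      ∑ n ∈ (Finset.Icc (fun _ : Fin 3 => -((2 ^ j : ℕ) : ℤ))
          (fun _ : Fin 3 => ((2 ^ j : ℕ) : ℤ))).erase 0,
        ENNReal.ofReal (4 * Real.pi ^ 2 * (∑ i, ((n i : ℤ) : ℝ) ^ 2) / L ^ 2) * w n ≤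
        ENNReal.ofReal (C * ((2 ^ j : ℕ) : ℝ) ^ 3 * (p + ((2 ^ j : ℕ) : ℝ) ^ 2 / L ^ 2))) :
    ∑ n ∈ (Finset.Icc (fun _ : Fin 3 => -((2 ^ J : ℕ) : ℤ))
        (fun _ : Fin 3 => ((2 ^ J : ℕ) : ℤ))).erase 0, w n ≤
      ENNReal.ofReal (2 * C / Real.pi ^ 2 * (p * L ^ 2 * 2 ^ J + (2 ^ J) ^ 3)) := by
  have hL0 : L ≠ 0 := hL.ne'
  have hπ : Real.pi ≠ 0 := Real.pi_ne_zero
  induction J with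
  | zero =>
    -- the innermost cube `0 < ‖n‖_∞ ≤ 1`: `|n|² ≥ 1`
    have h1 : ∀ n ∈ (Finset.Icc (fun _ : Fin 3 => -((2 ^ 0 : ℕ) : ℤ))
        (fun _ : Fin 3 => ((2 ^ 0 : ℕ) : ℤ))).erase 0,
        1 ≤ L ^ 2 / (4 * Real.pi ^ 2) * (4 * Real.pi ^ 2 * (∑ i, ((n i : ℤ) : ℝ) ^ 2) / L ^ 2) := by
      intro n hn
      have h := one_le_normSq_of_ne_zero (Finset.mem_erase.1 hn).1
      rwa [show L ^ 2 / (4 * Real.pi ^ 2) * (4 * Real.pi ^ 2 * (∑ i, ((n i : ℤ) : ℝ) ^ 2) / L ^ 2) =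
        (∑ i, ((n i : ℤ) : ℝ) ^ 2) by field_simp]
    refine (sum_le_ofReal_mul_sum_weighted (by positivity) _ w h1).trans ?_
    refine (mul_le_mul' le_rfl (hB 0 le_rfl)).trans ?_
    rw [← ENNReal.ofReal_mul (by positivity)]
    refine ENNReal.ofReal_le_ofReal ?_
    simp only [pow_zero, Nat.cast_one, one_pow, mul_one]
    rw [show L ^ 2 / (4 * Real.pi ^ 2) * (C * (p + 1 / L ^ 2)) =
      2 * C / Real.pi ^ 2 * (p * L ^ 2 + 1) / 8 by field_simp; ring]
    have h2 : 0 ≤ 2 * C / Real.pi ^ 2 * (p * L ^ 2 + 1) := by positivity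
    linarith
  | succ J ih =>
    have ih' := ih fun j hj => hB j (hj.trans (Nat.le_succ J))
    set s : Finset (Fin 3 → ℤ) := Finset.Icc (fun _ : Fin 3 => -((2 ^ J : ℕ) : ℤ))
      (fun _ : Fin 3 => ((2 ^ J : ℕ) : ℤ)) with hs
    set t : Finset (Fin 3 → ℤ) := Finset.Icc (fun _ : Fin 3 => -((2 ^ (J + 1) : ℕ) : ℤ))
      (fun _ : Fin 3 => ((2 ^ (J + 1) : ℕ) : ℤ)) with ht
    have hst : s ⊆ t := cube_mono (Nat.pow_le_pow_right two_pos (Nat.le_succ J))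
    have hsub : t.erase 0 ⊆ s.erase 0 ∪ (t \ s) := by
      intro n hn
      rw [Finset.mem_union, Finset.mem_erase, Finset.mem_sdiff]
      rw [Finset.mem_erase] at hn
      by_cases hns : n ∈ s
      · exact Or.inl ⟨hn.1, hns⟩
      · exact Or.inr ⟨hn.2, hns⟩
    have hdisj : Disjoint (s.erase 0) (t \ s) :=
      Finset.disjoint_sdiff.mono_left (Finset.erase_subset 0 s)
    -- the dyadic shell `2^J < ‖n‖_∞ ≤ 2^{J+1}`
    have hX0 : (0 : ℝ) < 2 ^ J := by positivity
    have hshell : ∑ n ∈ t \ s, w n ≤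
        ENNReal.ofReal (C / Real.pi ^ 2 * (p * L ^ 2 * 2 ^ (J + 1) + (2 ^ (J + 1)) ^ 3)) := by
      have h1 : ∀ n ∈ t \ s,
          1 ≤ L ^ 2 / (4 * Real.pi ^ 2 * (2 ^ J) ^ 2) *
            (4 * Real.pi ^ 2 * (∑ i, ((n i : ℤ) : ℝ) ^ 2) / L ^ 2) := by
        intro n hn
        have hns : n ∉ s := (Finset.mem_sdiff.1 hn).2
        have h2 := sq_le_normSq_of_not_mem_cube hns
        push_cast at h2
        rw [show L ^ 2 / (4 * Real.pi ^ 2 * (2 ^ J) ^ 2) *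
            (4 * Real.pi ^ 2 * (∑ i, ((n i : ℤ) : ℝ) ^ 2) / L ^ 2) =
          (∑ i, ((n i : ℤ) : ℝ) ^ 2) / (2 ^ J) ^ 2 by field_simp, le_div_iff₀ (by positivity)]
        nlinarith [h2, hX0]
      refine (sum_le_ofReal_mul_sum_weighted (by positivity) _ w h1).trans ?_
      have h3 :
          ∑ n ∈ t \ s, ENNReal.ofReal (4 * Real.pi ^ 2 * (∑ i, ((n i : ℤ) : ℝ) ^ 2) / L ^ 2) * w n ≤
          ∑ n ∈ t.erase 0,
            ENNReal.ofReal (4 * Real.pi ^ 2 * (∑ i, ((n i : ℤ) : ℝ) ^ 2) / L ^ 2) * w n :=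
        Finset.sum_le_sum_of_subset fun n hn => Finset.mem_erase.2
          ⟨fun h0 => (Finset.mem_sdiff.1 hn).2 (h0 ▸ zero_mem_cube _), (Finset.mem_sdiff.1 hn).1⟩
      refine (mul_le_mul' le_rfl (h3.trans (hB (J + 1) le_rfl))).trans ?_
      rw [← ENNReal.ofReal_mul (by positivity)]
      refine ENNReal.ofReal_le_ofReal (le_of_eq ?_)
      push_cast
      rw [pow_succ (2 : ℝ) J]
      field_simp
      ring
    calc ∑ n ∈ t.erase 0, w n ≤ ∑ n ∈ s.erase 0 ∪ (t \ s), w n := Finset.sum_le_sum_of_subset hsub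
      _ = ∑ n ∈ s.erase 0, w n + ∑ n ∈ t \ s, w n := Finset.sum_union hdisj
      _ ≤ ENNReal.ofReal (2 * C / Real.pi ^ 2 * (p * L ^ 2 * 2 ^ J + (2 ^ J) ^ 3)) +
          ENNReal.ofReal (C / Real.pi ^ 2 * (p * L ^ 2 * 2 ^ (J + 1) + (2 ^ (J + 1)) ^ 3)) :=
        add_le_add ih' hshell
      _ = ENNReal.ofReal (2 * C / Real.pi ^ 2 * (p * L ^ 2 * 2 ^ J + (2 ^ J) ^ 3) +
          C / Real.pi ^ 2 * (p * L ^ 2 * 2 ^ (J + 1) + (2 ^ (J + 1)) ^ 3)) := by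
        rw [← ENNReal.ofReal_add (by positivity) (by positivity)]
      _ ≤ ENNReal.ofReal (2 * C / Real.pi ^ 2 * (p * L ^ 2 * 2 ^ (J + 1) + (2 ^ (J + 1)) ^ 3)) := by
        refine ENNReal.ofReal_le_ofReal ?_
        have hkey : 2 * C / Real.pi ^ 2 * (p * L ^ 2 * 2 ^ J + (2 ^ J) ^ 3) +
            C / Real.pi ^ 2 * (p * L ^ 2 * 2 ^ (J + 1) + (2 ^ (J + 1)) ^ 3) =
            2 * C / Real.pi ^ 2 * (p * L ^ 2 * 2 ^ (J + 1) + (2 ^ (J + 1)) ^ 3) -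
              6 * (C / Real.pi ^ 2) * ((2 : ℝ) ^ J) ^ 3 := by ring
        have hpos : 0 ≤ 6 * (C / Real.pi ^ 2) * ((2 : ℝ) ^ J) ^ 3 := by positivity
        linarith

/-- Dyadic cut-offs exist: every `y ≥ 0` lies below a power of two that is at most `2y + 2`.
[folklore] -/
theorem exists_pow_two_near {y : ℝ} (hy : 0 ≤ y) :
    ∃ J : ℕ, y ≤ 2 ^ J ∧ (2 : ℝ) ^ J ≤ 2 * y + 2 := by
  obtain ⟨n, hn1, hn2⟩ := exists_nat_pow_near (le_max_right y 1) one_lt_two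
  refine ⟨n + 1, (le_max_left y 1).trans hn2.le, ?_⟩
  rw [pow_succ]
  have : max y 1 ≤ y + 1 := max_le (by linarith) (by linarith)
  linarith

/-- **The infrared arithmetic.** With `ρL³ = N`, a dyadic cut-off `X ≤ 2κ√ρL + 2` and the
thresholds `8K√ρ ≤ 1` (`K = 2C(2κa + 32κ³) + 1`), `L ≥ 64Ca`, `N ≥ 1024C`, the dyadic bound
`(2C/π²)(ρaL²X + X³)` is at most `N/4`: indeed `ρaL²X ≤ 2κa√ρN + 2ρaL²`,
`X³ ≤ 8(κ√ρL + 1)³ ≤ 32κ³√ρN + 32`, so the bound is `≤ (K-1)√ρN + 4CaρL² + 64C ≤ N/8 + N/16 + N/16`.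
[folklore] -/
theorem ir_arith {C κ a ρ L N X K : ℝ} (hC : 0 ≤ C) (hκ : 0 ≤ κ) (ha : 0 ≤ a) (hρ : 0 < ρ)
    (hL : 0 < L) (hN : 0 ≤ N) (hL3 : ρ * L ^ 3 = N) (hX0 : 0 ≤ X)
    (hX : X ≤ 2 * (κ * Real.sqrt ρ * L) + 2) (hK : K = 2 * C * (2 * κ * a + 32 * κ ^ 3) + 1)
    (hsqrtρ : 8 * K * Real.sqrt ρ ≤ 1) (hLa : 64 * C * a ≤ L) (hNC : 1024 * C ≤ N) :
    2 * C / Real.pi ^ 2 * (ρ * a * L ^ 2 * X + X ^ 3) ≤ N / 4 := by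
  set s : ℝ := Real.sqrt ρ with hs
  have hs0 : 0 ≤ s := Real.sqrt_nonneg ρ
  have hsq : s ^ 2 = ρ := Real.sq_sqrt hρ.le
  set Y : ℝ := κ * s * L with hY
  have hY0 : 0 ≤ Y := by positivity
  have hY3 : Y ^ 3 = κ ^ 3 * s * N := by
    rw [← hL3, ← hsq, hY]
    ring
  -- the first term: `ρaL²X ≤ 2κa√ρN + 2ρaL²`
  have h1 : ρ * a * L ^ 2 * X ≤ 2 * κ * a * s * N + 2 * (ρ * a * L ^ 2) := by
    have h11 : ρ * a * L ^ 2 * X ≤ ρ * a * L ^ 2 * (2 * Y + 2) :=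
      mul_le_mul_of_nonneg_left hX (by positivity)
    have h12 : ρ * a * L ^ 2 * (2 * Y + 2) = 2 * κ * a * s * N + 2 * (ρ * a * L ^ 2) := by
      rw [← hL3, ← hsq, hY]
      ring
    linarith
  -- the second term: `X³ ≤ (2Y+2)³ ≤ 32Y³ + 32 = 32κ³√ρN + 32`
  have h2 : X ^ 3 ≤ 32 * κ ^ 3 * s * N + 32 := by
    have h4 : X ^ 3 ≤ (2 * Y + 2) ^ 3 := pow_le_pow_left₀ hX0 hX 3
    have h5 : (2 * Y + 2) ^ 3 ≤ 32 * Y ^ 3 + 32 := by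
      have h6 : 32 * Y ^ 3 + 32 - (2 * Y + 2) ^ 3 = 24 * ((Y - 1) ^ 2 * (Y + 1)) := by ring
      have h7 : 0 ≤ 24 * ((Y - 1) ^ 2 * (Y + 1)) := by positivity
      linarith
    linarith [h4, h5, hY3]
  -- drop `π²`
  have hπ : 1 ≤ Real.pi ^ 2 := one_le_pow₀ (by linarith [Real.two_le_pi])
  have hS0 : 0 ≤ 2 * C * (ρ * a * L ^ 2 * X + X ^ 3) := by positivity
  have hmain : 2 * C / Real.pi ^ 2 * (ρ * a * L ^ 2 * X + X ^ 3) ≤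
      2 * C * (ρ * a * L ^ 2 * X + X ^ 3) := by
    rw [div_mul_eq_mul_div]
    exact div_le_self hS0 hπ
  refine hmain.trans ?_
  have h6 : 2 * C * (ρ * a * L ^ 2 * X + X ^ 3) ≤
      (K - 1) * s * N + 4 * C * a * (ρ * L ^ 2) + 64 * C := by
    calc 2 * C * (ρ * a * L ^ 2 * X + X ^ 3)
        ≤ 2 * C * ((2 * κ * a * s * N + 2 * (ρ * a * L ^ 2)) + (32 * κ ^ 3 * s * N + 32)) :=
          mul_le_mul_of_nonneg_left (add_le_add h1 h2) (by positivity)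
      _ = (K - 1) * s * N + 4 * C * a * (ρ * L ^ 2) + 64 * C := by
          rw [hK]
          ring
  have h7 : (K - 1) * s * N ≤ N / 8 := by
    have h71 : (K - 1) * s ≤ 1 / 8 := by linarith
    calc (K - 1) * s * N ≤ 1 / 8 * N := mul_le_mul_of_nonneg_right h71 hN
      _ = N / 8 := by ring
  have h8 : 4 * C * a * (ρ * L ^ 2) ≤ N / 16 := by
    have h81 := mul_le_mul_of_nonneg_left hLa (by positivity : (0 : ℝ) ≤ ρ * L ^ 2 / 16)
    have h82 : ρ * L ^ 2 / 16 * L = N / 16 := by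
      rw [← hL3]
      ring
    linarith
  have h9 : 64 * C ≤ N / 16 := by linarith
  linarith [h6, h7, h8, h9]

/-! ## §3 The counting step in abstract form -/

/-- **Mode counting on the torus (abstract form, cube version).** Let `Ψ` be a periodic `N`-body
state on the torus of side `L`, `n_k = ⟨φ_k, γ_Ψ φ_k⟩` its plane-wave occupations, `M ∈ ℕ` a cube
radius. Suppose (UV) `D ≤ |2πk/L|²` for `‖k‖_∞ > M`, with `D⁻¹⟨Ψ,HΨ⟩ ≤ N/4`, and (IR)
`∑_{0 < ‖k‖_∞ ≤ M} n_k ≤ N/4`. Then `⟨Ψ, n₀Ψ⟩ ≥ N/2`, since by Parseval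
`N = ∑_k n_k ≤ n₀ + ∑_{IR} n_k + D⁻¹∑_k|2πk/L|²n_k ≤ n₀ + N/4 + D⁻¹⟨Ψ,HΨ⟩`.
[cite: LSSY2005, §1.2 (1.17)–(1.19)] -/
theorem condensate_ge_half_of_cube {N : ℕ} {L : ℝ} (hL : 0 < L) (v : ℝ → ℝ≥0∞)
    (Ψ : PeriodicTrialState N L) (M : ℕ) {D : ℝ≥0∞} (hD0 : D ≠ 0) (hDtop : D ≠ ⊤)
    (hUV : ∀ k : Fin 3 → ℤ, k ∉ Finset.Icc (fun _ : Fin 3 => -(M : ℤ)) (fun _ : Fin 3 => (M : ℤ)) →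
      D ≤ fracDispersion 2 L k)
    (hT : D⁻¹ * periodicEnergy v Ψ ≤ ENNReal.ofReal (N / 4))
    (hIR : ∑ k ∈ (Finset.Icc (fun _ : Fin 3 => -(M : ℤ)) (fun _ : Fin 3 => (M : ℤ))).erase 0,
      cellOccupation N L (fun x => ((Real.sqrt (L ^ 3))⁻¹ : ℂ) * cellWave L k x) Ψ.ψ ≤
        ENNReal.ofReal (N / 4)) :
    ENNReal.ofReal (1 / 2 * N) ≤ condensateOccupation N L Ψ.ψ := by
  -- adapted from `ModeCounting.condensate_ge_half` (BECGroundStateSOSIRModeCounting)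
  classical
  set n : (Fin 3 → ℤ) → ℝ≥0∞ := fun k => cellOccupation N L (planeWaveMode L k) Ψ.ψ with hn
  set S : Finset (Fin 3 → ℤ) :=
    (Finset.Icc (fun _ : Fin 3 => -(M : ℤ)) (fun _ : Fin 3 => (M : ℤ))).erase 0 with hS
  have hm : ∀ k : Fin 3 → ℤ,
      planeWaveMode L k = fun x => ((Real.sqrt (L ^ 3))⁻¹ : ℂ) * cellWave L k x :=
    fun k => funext fun x => planeWaveMode_eq L k x
  have hIR' : ∑ k ∈ S, n k ≤ ENNReal.ofReal (N / 4) := by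
    refine le_of_eq_of_le (Finset.sum_congr rfl fun k _ => ?_) hIR
    show cellOccupation N L (planeWaveMode L k) Ψ.ψ = _
    rw [hm k]
  -- pointwise three-way bound: zero mode / infrared cube / ultraviolet tail
  have hpt : ∀ k, n k ≤ (if k = 0 then n k else 0) +
      (if k ∈ S then n k else 0) + D⁻¹ * (fracDispersion 2 L k * n k) := by
    intro k
    by_cases hk0 : k = 0
    · rw [if_pos hk0]
      exact le_add_right (le_add_right le_rfl)
    · by_cases hkM : k ∈ Finset.Icc (fun _ : Fin 3 => -(M : ℤ)) (fun _ : Fin 3 => (M : ℤ))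
      · have hkS : k ∈ S := Finset.mem_erase.2 ⟨hk0, hkM⟩
        rw [if_neg hk0, if_pos hkS, zero_add]
        exact le_add_right le_rfl
      · refine le_add_left ?_
        calc n k = D⁻¹ * D * n k := by rw [ENNReal.inv_mul_cancel hD0 hDtop, one_mul]
          _ ≤ D⁻¹ * fracDispersion 2 L k * n k := by gcongr; exact hUV k hkM
          _ = D⁻¹ * (fracDispersion 2 L k * n k) := mul_assoc _ _ _
  -- the ultraviolet tail carries at most `N/4`
  have hTsum : D⁻¹ * ∑' k, fracDispersion 2 L k * n k ≤ ENNReal.ofReal (N / 4) := by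
    refine le_trans ?_ hT
    gcongr
    calc ∑' k, fracDispersion 2 L k * n k = ∫⁻ X in cellN N L, kineticDensity Ψ.ψ X :=
          tsum_fracDispersion_two_mul_cellOccupation hL Ψ
      _ ≤ periodicEnergy v Ψ := lintegral_mono fun X => le_self_add
  -- Parseval and summation of the pointwise bound
  have hS' : ∑ k ∈ S, (if k ∈ S then n k else 0) = ∑ k ∈ S, n k :=
    Finset.sum_congr rfl fun k hk => if_pos hk
  have hsum : (N : ℝ≥0∞) ≤ n 0 + ENNReal.ofReal (N / 4) + ENNReal.ofReal (N / 4) := by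
    calc (N : ℝ≥0∞) = ∑' k, n k := (Ψ.tsum_cellOccupation_planeWaveMode hL).symm
      _ ≤ ∑' k, ((if k = 0 then n k else 0) + (if k ∈ S then n k else 0)
          + D⁻¹ * (fracDispersion 2 L k * n k)) := ENNReal.tsum_le_tsum hpt
      _ = n 0 + ∑ k ∈ S, n k + D⁻¹ * ∑' k, fracDispersion 2 L k * n k := by
          rw [ENNReal.tsum_add, ENNReal.tsum_add, tsum_ite_eq 0 n, ENNReal.tsum_mul_left,
            tsum_eq_sum (s := S) fun k hk => if_neg hk, hS']
      _ ≤ n 0 + ENNReal.ofReal (N / 4) + ENNReal.ofReal (N / 4) := by gcongr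
  -- conclusion: `N/2 + N/2 ≤ n₀ + N/2`
  have h2 : ENNReal.ofReal (1 / 2 * N) + ENNReal.ofReal (1 / 2 * N) = (N : ℝ≥0∞) := by
    rw [← ENNReal.ofReal_add (by positivity) (by positivity), ← ENNReal.ofReal_natCast]
    exact congrArg ENNReal.ofReal (by ring)
  have h4 : ENNReal.ofReal ((N : ℝ) / 4) + ENNReal.ofReal ((N : ℝ) / 4) =
      ENNReal.ofReal (1 / 2 * N) := by
    rw [← ENNReal.ofReal_add (by positivity) (by positivity)]
    exact congrArg ENNReal.ofReal (by ring)
  have hhalf : ENNReal.ofReal (1 / 2 * N) + ENNReal.ofReal (1 / 2 * N) ≤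
      n 0 + ENNReal.ofReal (1 / 2 * N) := by
    rw [h2, ← h4, ← add_assoc]
    exact hsum
  have h0 : n 0 = condensateOccupation N L Ψ.ψ := cellOccupation_planeWaveMode_zero N L Ψ.ψ
  rw [← h0]
  exact ENNReal.le_of_add_le_add_right ENNReal.ofReal_ne_top hhalf

end ShellCounting

end Summit.AtomisticToContinuum.BoseEinsteinCondensation.Theorems

end
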